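import Mathlib
import HarnessLib
import Literature.Computability.Complexity.CNF
import Literature.Computability.Complexity.RandomKSatUniformlyPos
import Summits.PneNP.PneNP.Theses.OverlapGapAlgebra
import Summits.PneNP.PneNP.Theorems.OverlapGapAlgebraAssembly
import Summits.PneNP.PneNP.Theorems.OverlapGapAlgebraEvalRelationInP
import Summits.PneNP.PneNP.Theorems.OverlapGapAlgebraPositiveSatProbability

/-!
# PneNP / OverlapGapAlgebra — `SearchHardWindow` (stmt-PneNP-2460): reduction certificate

Two unconditional facts that locate the crux `SearchHardWindow` (random `k`-SAT search is hard
for all of `P` at some density with uniformly positive satisfiability; Achlioptas–Peres 2004, §11,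
Question 2 at one `(k, α)`) for the planners and the crux's disprover:

* `searchHardWindow_implies_pneNP` — **strength**: the crux ALONE implies the summit statement
  `PneNP` (composition of the accepted assembly `overlapGapAlgebra_assembly_proof` with the accepted
  plumbing theorem `overlapGap_evalRelationInP`). So any proof of the crux is a proof of `P ≠ NP`;
  compare `pneNP_of_cruxes` (`OverlapGapAlgebraSearchHardWindowFromCruxes.lean`), which starts from
  the two upstream cruxes instead.
* `searchHardWindow_of_hard_below_rho` / `searchHardWindow_of_hard_at_window` — **residual core**:
  since uniformly positive satisfiability is an unconditional tree theorem
  (`achlioptasPeres2004_uniformlyPos`, Achlioptas–Peres 2004) for `k ≥ 1024` and every density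
  `r < ρ_k`, the crux follows from its bare hardness conjunct ("every polynomial-time `f` has
  success probability `→ 0`") at any one such `(k, r)` — in particular at the window density
  `α_k = 5 · 2^k log k / k`. Future lines may therefore target the hardness conjunct alone.

Tightness in the other direction (the statement is false once `IsPolyTime` is deleted, and the
window boundaries `0 < α < 2^k log 2`, `k ≥ 1`) is the crux disprover's
`Theorems/SearchHardWindow/Negative/{FalseWithoutPolyTime,WindowBoundaries}.lean`.

Prover prover-PneNP-route-PneNP-OverlapGapAlgebra-3, 2026-08-16.
-/

namespace Summit.PneNP.PneNP.Theorems

set_option linter.dupNamespace false -- `Summit.PneNP.PneNP.…`: summit = sub-problem (D-0017)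

open Filter Literature.Computability.Complexity
open Summit.PneNP.PneNP.Theses.OverlapGapAlgebra

/-- **Strength certificate.** The crux `SearchHardWindow` of route OverlapGapAlgebra implies the
summit statement `PneNP` (Cook's Clay formulation), unconditionally: the accepted assembly
`overlapGapAlgebra_assembly_proof : EvalRelationInP → SearchHardWindow → PneNP` composed with the
accepted plumbing theorem `overlapGap_evalRelationInP : EvalRelationInP`.
[AroraBarakCC2009, Thm. 2.18; AchlioptasPeres2004, §11 Question 2] -/
theorem searchHardWindow_implies_pneNP : SearchHardWindow → _root_.PneNP :=
  fun hX => overlapGapAlgebra_assembly_proof overlapGap_evalRelationInP hX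

/-- **Residual core, general density.** For `k ≥ 1024` and any density `r` below the
Achlioptas–Peres radius `ρ_k = (2^k log 2 - (k+1) log 2 / 2 - 1) - 2 δ_k` of
`achlioptasPeres2004_uniformlyPos`, the bare hardness conjunct at `(k, r)` — every polynomial-time
`f` solves `F_k(n, ⌊r n⌋)` with probability `→ 0` — already gives `SearchHardWindow` (the
positivity conjunct being an unconditional tree theorem). [AchlioptasPeres2004, Thm. 2 and §7] -/
theorem searchHardWindow_of_hard_below_rho {k : ℕ} (hk : 1024 ≤ k) {r : ℝ}
    (hr : r < (2 ^ k * Real.log 2 - ((k : ℝ) + 1) * Real.log 2 / 2 - 1) -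
      2 * (15 * (k : ℝ) ^ 2 / 2 ^ k + (((k : ℝ) + 3) / 2 ^ k + 32 * (k : ℝ) ^ 2 * (50 / 81) ^ k +
        32 * (k : ℝ) * (5 / 9) ^ k)))
    (hhard : ∀ f : List Bool → List Bool, IsPolyTime f → ∀ ε : ℝ, 0 < ε →
      ∀ᶠ n : ℕ in atTop, ∀ m : ℕ, m = ⌊r * n⌋₊ →
        ((Finset.univ.filter fun Φ : Fin m → Fin k → Fin n × Bool => ∀ i, ∃ j,
          (f (encodingCNF.encode (List.ofFn fun a => List.ofFn fun b =>
            (((Φ a b).1 : ℕ), (Φ a b).2)))).getD (Φ i j).1 false = (Φ i j).2).card : ℝ) /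
          Fintype.card (Fin m → Fin k → Fin n × Bool) ≤ ε) :
    SearchHardWindow := by
  obtain ⟨c, hc, hev⟩ := achlioptasPeres2004_uniformlyPos hk hr
  refine ⟨k, r, ⟨c, hc, ?_⟩, hhard⟩
  filter_upwards [hev] with n hn m hm
  subst hm
  simpa [litArraySatProb, LitArraySat] using hn

/-- **Residual core at the window density.** For `k ≥ 1024`, hardness of `F_k(n, ⌊α_k n⌋)` for all
of `P` at `α_k = 5 · 2^k log k / k` (the Bresler–Huang OGP window density used throughout the route)
gives `SearchHardWindow`; `α_k < ρ_k` is `positiveSatProbability_window_density_lt_rho`.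
[AchlioptasPeres2004, Thm. 2; BreslerHuang2022, Thm. 2.6] -/
theorem searchHardWindow_of_hard_at_window {k : ℕ} (hk : 1024 ≤ k)
    (hhard : ∀ f : List Bool → List Bool, IsPolyTime f → ∀ ε : ℝ, 0 < ε →
      ∀ᶠ n : ℕ in atTop, ∀ m : ℕ, m = ⌊5 * 2 ^ k * Real.log k / k * n⌋₊ →
        ((Finset.univ.filter fun Φ : Fin m → Fin k → Fin n × Bool => ∀ i, ∃ j,
          (f (encodingCNF.encode (List.ofFn fun a => List.ofFn fun b =>
            (((Φ a b).1 : ℕ), (Φ a b).2)))).getD (Φ i j).1 false = (Φ i j).2).card : ℝ) /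
          Fintype.card (Fin m → Fin k → Fin n × Bool) ≤ ε) :
    SearchHardWindow :=
  searchHardWindow_of_hard_below_rho hk (positiveSatProbability_window_density_lt_rho hk) hhard

end Summit.PneNP.PneNP.Theorems
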